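import Summits.HodgeConjecture.HodgeConjecture.Theorems.HodgeLocusCensusPlaneSumRank6
import Summits.HodgeConjecture.HodgeConjecture.Theorems.HodgeLocusCensusPlaneSumRank8
import Summits.HodgeConjecture.HodgeConjecture.Theorems.HodgeLocusCensusPlaneSumCertsD
import Summits.HodgeConjecture.HodgeConjecture.Theorems.HodgeLocusCensusQuarticRows
import Summits.HodgeConjecture.HodgeConjecture.Theorems.HodgeLocusCensusFiveTuple641
import HarnessLib

/-!
# HodgeLocusCensusQuarticRowsPlaneSum — PROVED: the quartic two-planes rows (6,4,1 | 36) and (8,4,2 | 83) of `HodgeLocusCensusQuarticRows` (cell pub-hlocus, LEAD gen 5, (T38))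
HONEST FRAMING: certified instances and evidence bearing on the general Hodge conjecture; no claim.

The rows `explainedSmooth_6_4_1_difference` (δ = [P] − [P_c], P ∩ P_c = P¹ in the Fermat quartic sixfold, rank 36) and
`explainedSmooth_8_4_2_difference` (P ∩ P_c = P² in the eightfold, rank 83) are stated for the schema planes `standardP n` (all twists 0) and
`standardPc n m 1` (twist 1 on the LAST two pairs). A permutation of the coordinate PAIRS is a symmetry of the whole set-up: for an involution
π of the coordinates mapping pairs to pairs, p_i(Π_{a∘π}) = p_{i∘π}(Π_a) (`period` with b = id), so Movasati's matrix of the pair-permuted class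
is the original matrix REINDEXED by i ↦ i∘π on rows and columns (`ivhsMatrix_PPc6/8`), and the rank is unchanged (`Matrix.rank_reindex`).
Swapping the last two pairs to the front turns δ into the plane list of the class `diffPPcL` = [(1, 0,0,0), (−1, 1,1,0)] of
`HodgeLocusCensusPlaneSumCertsD`, whose ranks 36 / 83 are decided by `ivhsRankEq_of_cert6/8` and the kernel-checked certificate.
What is proved is the typed first-order statement (rank of Movasati's matrix = 36 / 83); the rows' EXPLAINED-SMOOTH labels (R17 dimension
certificates, the CI(2,2,1,1)/(2,2,1,1,1) families) are records of the cell and are untouched.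
-/

namespace Summit.HodgeConjecture.HodgeConjecture.HodgeLocus.Census.PlaneSum

open TwistCells GrSection

/-! ## the schema planes as twisted coordinate planes (n = 6: `FiveTuple641.standardP6_eq/standardPc6_eq`) -/

/-- P of the eightfold is the coordinate 4-plane with twists (0,0,0,0,0) … -/
theorem standardP8_eq : standardP 8 = plane84 0 0 0 0 0 := by
  unfold standardP plane84
  congr 1
  funext e
  fin_cases e <;> rfl

/-- … and P_c (m = 2, t = 1) has twists (0,0,0,1,1). -/
theorem standardPc8_eq : standardPc 8 2 1 = plane84 0 0 0 1 1 := by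
  unfold standardPc plane84
  congr 1
  funext e
  fin_cases e <;> rfl

/-- the plane list of `diffPPcL` on X⁴₆ … -/
theorem diffPPc_list6 : planeList6 diffPPcL = [(1, plane64 0 0 0 0), (-1, plane64 1 1 0 0)] := by
  simp [planeList6, diffPPcL]

/-- … and on X⁴₈. -/
theorem diffPPc_list8 : planeList8 diffPPcL = [(1, plane84 0 0 0 0 0), (-1, plane84 1 1 0 0 0)] := by
  simp [planeList8, diffPPcL]

/-! ## pair permutations -/

/-- the coordinate involution of X⁴₆ swapping the pairs (01)(23) with (45)(67) … -/
def sw6 : Fin 8 → Fin 8 := ![4, 5, 6, 7, 0, 1, 2, 3]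

/-- … is an involution. -/
theorem sw6_sw6 (e : Fin 8) : sw6 (sw6 e) = e := by
  fin_cases e <;> rfl

/-- the coordinate involution of X⁴₈ swapping the pairs (01)(23) with (67)(89), fixing (45) … -/
def sw8 : Fin 10 → Fin 10 := ![6, 7, 8, 9, 4, 5, 0, 1, 2, 3]

/-- … is an involution. -/
theorem sw8_sw8 (e : Fin 10) : sw8 (sw8 e) = e := by
  fin_cases e <;> rfl

/-- i ∘ sw6 stays in the index set … -/
theorem comp_sw6_mem {N : ℕ} (i : Fin 8 → ℕ) (hi : i ∈ indexSet 6 4 N) : (i ∘ sw6) ∈ indexSet 6 4 N := by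
  unfold indexSet at *
  simp only [Finset.mem_filter, Fintype.mem_piFinset, Finset.mem_range] at *
  refine ⟨fun e => hi.1 (sw6 e), ?_⟩
  rw [← hi.2, Fin.sum_univ_eight, Fin.sum_univ_eight]
  simp [sw6]
  ring

/-- … and so does i ∘ sw8. -/
theorem comp_sw8_mem {N : ℕ} (i : Fin 10 → ℕ) (hi : i ∈ indexSet 8 4 N) : (i ∘ sw8) ∈ indexSet 8 4 N := by
  unfold indexSet at *
  simp only [Finset.mem_filter, Fintype.mem_piFinset, Finset.mem_range] at *
  refine ⟨fun e => hi.1 (sw8 e), ?_⟩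
  rw [← hi.2]
  simp [Fin.sum_univ_succ, sw8]
  ring

/-- the reindexing of an index set of X⁴₆ by the pair swap … -/
def reidx6 (N : ℕ) : indexSet 6 4 N ≃ indexSet 6 4 N where
  toFun i := ⟨i.1 ∘ sw6, comp_sw6_mem i.1 i.2⟩
  invFun i := ⟨i.1 ∘ sw6, comp_sw6_mem i.1 i.2⟩
  left_inv i := Subtype.ext (funext fun e => by simp [sw6_sw6])
  right_inv i := Subtype.ext (funext fun e => by simp [sw6_sw6])

/-- … and of X⁴₈. -/
def reidx8 (N : ℕ) : indexSet 8 4 N ≃ indexSet 8 4 N where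
  toFun i := ⟨i.1 ∘ sw8, comp_sw8_mem i.1 i.2⟩
  invFun i := ⟨i.1 ∘ sw8, comp_sw8_mem i.1 i.2⟩
  left_inv i := Subtype.ext (funext fun e => by simp [sw8_sw8])
  right_inv i := Subtype.ext (funext fun e => by simp [sw8_sw8])

section field

variable {K : Type*} [Field K] (ζ : K)

/-- PAIR-PERMUTATION IDENTITY (n = 6): p_i([P] − [P_c]) = p_{i∘sw6}(Π(0,0,0,0) − Π(1,1,0,0)). -/
theorem periodComb_PPc6 (i : Fin 8 → ℕ) :
    periodComb 6 4 ζ [(1, standardP 6), (-1, standardPc 6 1 1)] i = periodComb 6 4 ζ (planeList6 diffPPcL) (i ∘ sw6) := by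
  rw [FiveTuple641.standardP6_eq, FiveTuple641.standardPc6_eq, diffPPc_list6]
  unfold periodComb
  simp only [List.map_cons, List.map_nil, List.sum_cons, List.sum_nil, period_plane64, Function.comp_apply]
  simp only [sw6, Matrix.cons_val_zero, Matrix.cons_val_one, Matrix.cons_val]
  by_cases h : i 0 + i 1 = 2 ∧ i 2 + i 3 = 2 ∧ i 4 + i 5 = 2 ∧ i 6 + i 7 = 2
  · simp only [h, and_self, if_true]
    ring
  · have h' : ¬ (i 4 + i 5 = 2 ∧ i 6 + i 7 = 2 ∧ i 0 + i 1 = 2 ∧ i 2 + i 3 = 2) := fun h' => h ⟨h'.2.2.1, h'.2.2.2, h'.1, h'.2.1⟩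
    simp only [h, h', if_false, mul_zero, add_zero]

/-- PAIR-PERMUTATION IDENTITY (n = 8): p_i([P] − [P_c]) = p_{i∘sw8}(Π(0,0,0,0,0) − Π(1,1,0,0,0)). -/
theorem periodComb_PPc8 (i : Fin 10 → ℕ) :
    periodComb 8 4 ζ [(1, standardP 8), (-1, standardPc 8 2 1)] i = periodComb 8 4 ζ (planeList8 diffPPcL) (i ∘ sw8) := by
  rw [standardP8_eq, standardPc8_eq, diffPPc_list8]
  unfold periodComb
  simp only [List.map_cons, List.map_nil, List.sum_cons, List.sum_nil, PlaneRank8.period_plane84, Function.comp_apply]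
  simp only [sw8, Matrix.cons_val_zero, Matrix.cons_val_one, Matrix.cons_val]
  by_cases h : i 0 + i 1 = 2 ∧ i 2 + i 3 = 2 ∧ i 4 + i 5 = 2 ∧ i 6 + i 7 = 2 ∧ i 8 + i 9 = 2
  · simp only [h, and_self, if_true]
    ring
  · have h' : ¬ (i 6 + i 7 = 2 ∧ i 8 + i 9 = 2 ∧ i 4 + i 5 = 2 ∧ i 0 + i 1 = 2 ∧ i 2 + i 3 = 2) :=
      fun h' => h ⟨h'.2.2.2.1, h'.2.2.2.2, h'.2.2.1, h'.1, h'.2.1⟩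
    simp only [h, h', if_false, mul_zero, add_zero]

/-- Movasati's matrix of [P] − [P_c] on X⁴₆ is the matrix of the pair-permuted class, reindexed. -/
theorem ivhsMatrix_PPc6 : ivhsMatrix 6 4 ζ [(1, standardP 6), (-1, standardPc 6 1 1)] =
    Matrix.reindex (reidx6 _).symm (reidx6 _).symm (ivhsMatrix 6 4 ζ (planeList6 diffPPcL)) := by
  ext i j
  show _ = ivhsMatrix 6 4 ζ (planeList6 diffPPcL) (reidx6 _ i) (reidx6 _ j)
  unfold ivhsMatrix
  rw [periodComb_PPc6]
  rfl

/-- … and on X⁴₈. -/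
theorem ivhsMatrix_PPc8 : ivhsMatrix 8 4 ζ [(1, standardP 8), (-1, standardPc 8 2 1)] =
    Matrix.reindex (reidx8 _).symm (reidx8 _).symm (ivhsMatrix 8 4 ζ (planeList8 diffPPcL)) := by
  ext i j
  show _ = ivhsMatrix 8 4 ζ (planeList8 diffPPcL) (reidx8 _ i) (reidx8 _ j)
  unfold ivhsMatrix
  rw [periodComb_PPc8]
  rfl

end field

/-- PROVED ROW: `explainedSmooth_6_4_1_difference` — rank [p_{i+j}([P] − [P_c])] = 36 on the Fermat quartic sixfold (P ∩ P_c = P¹). -/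
theorem explainedSmooth_6_4_1_difference_holds : explainedSmooth_6_4_1_difference := by
  unfold explainedSmooth_6_4_1_difference ExplainedSmoothRow IvhsRankEq
  intro K _ _ ζ hζ
  rw [ivhsMatrix_PPc6 ζ, Matrix.rank_reindex]
  exact ivhsRankEq_of_cert6 diffPPcL diffPPcCert diffPPc_valid diffPPcModeK6 diffPPcOff6 diffPPc_H1_6 diffPPc_H2_6 diffPPc_H3_6 K ζ hζ

/-- PROVED ROW: `explainedSmooth_8_4_2_difference` — rank [p_{i+j}([P] − [P_c])] = 83 on the Fermat quartic eightfold (P ∩ P_c = P²). -/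
theorem explainedSmooth_8_4_2_difference_holds : explainedSmooth_8_4_2_difference := by
  unfold explainedSmooth_8_4_2_difference ExplainedSmoothRow IvhsRankEq
  intro K _ _ ζ hζ
  rw [ivhsMatrix_PPc8 ζ, Matrix.rank_reindex]
  exact ivhsRankEq_of_cert8 diffPPcL diffPPcCert diffPPc_valid diffPPcModeK8 diffPPcOff8 diffPPc_H1_8 diffPPc_H2_8 diffPPc_H3_8 K ζ hζ

end Summit.HodgeConjecture.HodgeConjecture.HodgeLocus.Census.PlaneSum
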